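import Literature.NumberTheory.Irrationality.KrattenthalerZudilin2019.ZetaOddMinusPiPowers
import HarnessLib

/-!
# Krattenthaler–Zudilin 2019, §2: majorants for the `r̃_n` summand and for the telescoping certificate

Proofs-only companion (file 2 of 3) of `ZetaOddMinusPiPowers.lean` towards the named facts
`catalanR_eq_catalanRTilde` and `catalanRTilde_integrality` of [KrattenthalerZudilin2019, §2]; independent of
file 1 (`CatalanRTildeTelescopeProofs`).  It supplies the two analytic inputs the summation of the
creative-telescoping identity needs, each with an EXPLICIT majorant:
* `summand_nonneg`, `summand_le`: the summand `a_n(u) = (2u+1)(2n+1)!∏_{j<2n}(u+1−n+j)/∏_{j<2n+2}(2u−n+½+j)²`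
  of `catalanRTilde n` (written exactly as the definition unfolds) satisfies `0 ≤ a_n(u) ≤ 4(2n+1)!/(2u+1)²`
  for all `n, u ∈ ℕ` (for `u < n` a numerator factor vanishes; for `u ≥ n` pair the `j`-th numerator factor with
  the `(j+1)`-st denominator factor) — so every `Σ_u a_n(u)` converges (a very-well-poised series at `z = 1`);
* `certificate_abs_le`, `certificate_tendsto_zero`: the certificate `V_m` of file 1 obeys
  `|V_m(u)| ≤ (2m+2)!(|c₀|+|c₂|+|c₄|)/(8u²)` for `u ≥ m+2`, hence `V_m(u) → 0`; and `certificate_zero_tendsto_zero`: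
  the `n = 0` certificate `V⁰(u) → 0` (`0 ≤ V⁰(u) ≤ 6/u²` for `u ≥ 1`).
HONEST FRAMING (cell pub-zeta5): systematic search; elementary inequalities for explicitly given rational
functions; nothing here concerns the arithmetic nature of Catalan's constant.  Theorems only (no definitions).
-/

open Finset Filter
open scoped Nat Topology

namespace Literature.NumberTheory.Irrationality.KrattenthalerZudilin2019

namespace CatalanRTilde

/-! ### A product comparison -/

/-- Core comparison: if `0 ≤ e_i ≤ d_{i+1}` and `1 ≤ d_j`, then for `k ≥ 1`
`∏_{i<k} e_i / ∏_{j<k+2} d_j² ≤ 1/(d_0² · d_k · d_{k+1}²)` (pair `e_i` with `d_{i+1}`, keep `d_0, d_k, d_{k+1}`).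
[folklore] -/
private theorem core_bound (k : ℕ) (hk : 1 ≤ k) (e d : ℕ → ℝ) (he0 : ∀ i, 0 ≤ e i)
    (hed : ∀ i, e i ≤ d (i + 1)) (hd1 : ∀ j, 1 ≤ d j) :
    (∏ i ∈ range k, e i) / ∏ j ∈ range (k + 2), d j ^ 2 ≤ 1 / (d 0 ^ 2 * d k * d (k + 1) ^ 2) := by
  have hdpos : ∀ j, 0 < d j := fun j => lt_of_lt_of_le one_pos (hd1 j)
  set P : ℝ := ∏ i ∈ range k, d (i + 1) with hP
  have hsplit : ∏ j ∈ range (k + 2), d j ^ 2 = d 0 ^ 2 * P ^ 2 * d (k + 1) ^ 2 := by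
    rw [prod_range_succ, prod_range_succ', ← prod_pow]
    ring
  have hPpos : 0 < P := prod_pos fun i _ => hdpos _
  have hNle : ∏ i ∈ range k, e i ≤ P := prod_le_prod (fun i _ => he0 i) fun i _ => hed i
  have hNnn : 0 ≤ ∏ i ∈ range k, e i := prod_nonneg fun i _ => he0 i
  have hPge : d k ≤ P := by
    obtain ⟨k', rfl⟩ : ∃ k', k = k' + 1 := ⟨k - 1, by omega⟩
    rw [hP, prod_range_succ]
    have h1 : 1 ≤ ∏ i ∈ range k', d (i + 1) := by
      calc (1 : ℝ) = ∏ _i ∈ range k', (1 : ℝ) := by simp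
        _ ≤ ∏ i ∈ range k', d (i + 1) := prod_le_prod (fun _ _ => zero_le_one) fun i _ => hd1 _
    nlinarith [hdpos (k' + 1)]
  have h0 := hdpos 0
  have hk1 := hdpos (k + 1)
  have hkk := hdpos k
  rw [hsplit]
  calc (∏ i ∈ range k, e i) / (d 0 ^ 2 * P ^ 2 * d (k + 1) ^ 2)
      ≤ P / (d 0 ^ 2 * P ^ 2 * d (k + 1) ^ 2) := by
        gcongr
    _ = 1 / (d 0 ^ 2 * P * d (k + 1) ^ 2) := by
        field_simp
    _ ≤ 1 / (d 0 ^ 2 * d k * d (k + 1) ^ 2) := by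
        apply one_div_le_one_div_of_le (by positivity)
        gcongr

/-! ### Quarter-odd points never vanish -/

/-- `2u + k + ½ ≠ 0` for natural `u` and integer `k` (twice it is an odd integer). [folklore] -/
private theorem two_mul_add_half_ne_zero (u : ℕ) (k : ℤ) : (2 * (u : ℝ) + k + 1 / 2) ≠ 0 := by
  intro h
  have h2 : ((4 * (u : ℤ) + 2 * k + 1 : ℤ) : ℝ) = 0 := by push_cast; linarith
  have h3 : (4 * (u : ℤ) + 2 * k + 1 : ℤ) = 0 := by exact_mod_cast h2
  omega

/-! ### The summand of `r̃_n`: sign and majorant -/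

/-- The summand `a_n(u)` of `catalanRTilde n` is nonnegative at every natural `u` (its numerator is a product of
consecutive integers `u+1−n, …, u+n`, which vanishes unless they are all positive; the denominator is a square).
[cite: KrattenthalerZudilin2019, §2 (the family r̃_n)] -/
theorem summand_nonneg (n u : ℕ) :
    0 ≤ (2 * (u : ℝ) + 1) * ((2 * n + 1)! : ℝ) * (∏ j ∈ range (2 * n), ((u : ℝ) + 1 - n + j))
        / ∏ j ∈ range (2 * n + 2), (2 * (u : ℝ) - n + 1 / 2 + j) ^ 2 := by
  rcases lt_or_ge u n with h | h
  · obtain ⟨k, rfl⟩ := Nat.exists_eq_add_of_lt h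
    rw [prod_eq_zero (i := k) (mem_range.mpr (by omega)) (by push_cast; ring)]
    simp
  · refine div_nonneg (mul_nonneg (by positivity) (prod_nonneg fun j _ => ?_)) (prod_nonneg fun j _ => sq_nonneg _)
    have : (n : ℝ) ≤ u := by exact_mod_cast h
    have : (0 : ℝ) ≤ j := Nat.cast_nonneg j
    linarith

/-- **Majorant for the summand of `r̃_n`**: `a_n(u) ≤ 4·(2n+1)!/(2u+1)²` for all `n, u ∈ ℕ` — so the
very-well-poised series `Σ_u a_n(u)` (at `z = 1`) converges absolutely, termwise `O(u⁻²)`.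
[cite: KrattenthalerZudilin2019, §2 (the family r̃_n)] -/
theorem summand_le (n u : ℕ) :
    (2 * (u : ℝ) + 1) * ((2 * n + 1)! : ℝ) * (∏ j ∈ range (2 * n), ((u : ℝ) + 1 - n + j))
        / ∏ j ∈ range (2 * n + 2), (2 * (u : ℝ) - n + 1 / 2 + j) ^ 2
      ≤ 4 * ((2 * n + 1)! : ℝ) / (2 * (u : ℝ) + 1) ^ 2 := by
  rcases lt_or_ge u n with h | h
  · obtain ⟨k, rfl⟩ := Nat.exists_eq_add_of_lt h
    rw [prod_eq_zero (i := k) (mem_range.mpr (by omega)) (by push_cast; ring)]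
    simp only [mul_zero, zero_div]
    positivity
  have hnu : (n : ℝ) ≤ u := by exact_mod_cast h
  have hu0 : (0 : ℝ) ≤ u := Nat.cast_nonneg u
  rcases Nat.eq_zero_or_pos n with rfl | hn
  · -- `n = 0`: `a_0(u) = (2u+1)/((2u+½)(2u+3/2))²`
    simp only [Nat.mul_zero, Nat.zero_add, Nat.factorial_one, Nat.cast_one, mul_one, prod_range_zero,
      CharP.cast_eq_zero, sub_zero, prod_range_succ, one_mul, add_zero]
    rw [div_le_div_iff₀ (by positivity) (by positivity)]
    nlinarith [mul_nonneg hu0 hu0, mul_nonneg (mul_nonneg hu0 hu0) hu0,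
      mul_nonneg (mul_nonneg hu0 hu0) (mul_nonneg hu0 hu0)]
  · -- `n ≥ 1`, `u ≥ n`: the core comparison with `e_i = u+1−n+i`, `d_j = 2u−n+½+j`
    have hn1 : (1 : ℝ) ≤ n := by exact_mod_cast hn
    have hcore := core_bound (2 * n) (by omega) (fun i => (u : ℝ) + 1 - n + i)
      (fun j => 2 * (u : ℝ) - n + 1 / 2 + j) (fun i => by have := (Nat.cast_nonneg i : (0:ℝ) ≤ i); linarith)
      (fun i => by push_cast; linarith) (fun j => by have := (Nat.cast_nonneg j : (0:ℝ) ≤ j); linarith)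
    have hd0 : (3 : ℝ) / 2 ≤ 2 * (u : ℝ) - n + 1 / 2 + ((0 : ℕ) : ℝ) := by push_cast; linarith
    have hdk : 2 * (u : ℝ) + 1 ≤ 2 * (u : ℝ) - n + 1 / 2 + ((2 * n : ℕ) : ℝ) := by push_cast; linarith
    have hdk1 : 2 * (u : ℝ) + 1 ≤ 2 * (u : ℝ) - n + 1 / 2 + ((2 * n + 1 : ℕ) : ℝ) := by push_cast; linarith
    have hX : (9 : ℝ) / 4 * (2 * (u : ℝ) + 1) ^ 3
        ≤ (2 * (u : ℝ) - n + 1 / 2 + ((0 : ℕ) : ℝ)) ^ 2 * (2 * (u : ℝ) - n + 1 / 2 + ((2 * n : ℕ) : ℝ))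
          * (2 * (u : ℝ) - n + 1 / 2 + ((2 * n + 1 : ℕ) : ℝ)) ^ 2 := by
      have h9 : (9 : ℝ) / 4 ≤ (2 * (u : ℝ) - n + 1 / 2 + ((0 : ℕ) : ℝ)) ^ 2 := by nlinarith
      have h3 : (2 * (u : ℝ) + 1) ^ 2 ≤ (2 * (u : ℝ) - n + 1 / 2 + ((2 * n + 1 : ℕ) : ℝ)) ^ 2 :=
        pow_le_pow_left₀ (by positivity) hdk1 2
      calc (9 : ℝ) / 4 * (2 * (u : ℝ) + 1) ^ 3 = 9 / 4 * (2 * (u : ℝ) + 1) * (2 * (u : ℝ) + 1) ^ 2 := by ring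
        _ ≤ (2 * (u : ℝ) - n + 1 / 2 + ((0 : ℕ) : ℝ)) ^ 2 * (2 * (u : ℝ) - n + 1 / 2 + ((2 * n : ℕ) : ℝ))
          * (2 * (u : ℝ) - n + 1 / 2 + ((2 * n + 1 : ℕ) : ℝ)) ^ 2 :=
            mul_le_mul (mul_le_mul h9 hdk (by positivity) (sq_nonneg _)) h3 (by positivity)
              (mul_nonneg (sq_nonneg _) (by linarith))
    have hpos : 0 < (9 : ℝ) / 4 * (2 * (u : ℝ) + 1) ^ 3 := by positivity
    calc (2 * (u : ℝ) + 1) * ((2 * n + 1)! : ℝ) * (∏ j ∈ range (2 * n), ((u : ℝ) + 1 - n + j))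
          / ∏ j ∈ range (2 * n + 2), (2 * (u : ℝ) - n + 1 / 2 + j) ^ 2
        = (2 * (u : ℝ) + 1) * ((2 * n + 1)! : ℝ) * ((∏ j ∈ range (2 * n), ((u : ℝ) + 1 - n + j))
          / ∏ j ∈ range (2 * n + 2), (2 * (u : ℝ) - n + 1 / 2 + j) ^ 2) := by ring
      _ ≤ (2 * (u : ℝ) + 1) * ((2 * n + 1)! : ℝ)
          * (1 / ((2 * (u : ℝ) - n + 1 / 2 + ((0 : ℕ) : ℝ)) ^ 2 * (2 * (u : ℝ) - n + 1 / 2 + ((2 * n : ℕ) : ℝ))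
            * (2 * (u : ℝ) - n + 1 / 2 + ((2 * n + 1 : ℕ) : ℝ)) ^ 2)) :=
          mul_le_mul_of_nonneg_left hcore (by positivity)
      _ ≤ (2 * (u : ℝ) + 1) * ((2 * n + 1)! : ℝ) * (1 / (9 / 4 * (2 * (u : ℝ) + 1) ^ 3)) := by
          gcongr
      _ = 4 / 9 * ((2 * n + 1)! : ℝ) / (2 * (u : ℝ) + 1) ^ 2 := by
          field_simp
      _ ≤ 4 * ((2 * n + 1)! : ℝ) / (2 * (u : ℝ) + 1) ^ 2 := by
          gcongr
          norm_num

/-! ### The certificate: majorant and decay -/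

/-- A quartic with no odd terms is `O(x⁴)` with an explicit constant: `|c₀ + c₂x² + c₄x⁴| ≤ (|c₀|+|c₂|+|c₄|)x⁴`
for `x ≥ 1`. [folklore] -/
private theorem abs_quartic_le (c0 c2 c4 x : ℝ) (hx : 1 ≤ x) :
    |c0 + c2 * x ^ 2 + c4 * x ^ 4| ≤ (|c0| + |c2| + |c4|) * x ^ 4 := by
  have hx2 : 1 ≤ x ^ 2 := by nlinarith
  have hx4 : x ^ 2 ≤ x ^ 4 := by nlinarith
  have h14 : 1 ≤ x ^ 4 := le_trans hx2 hx4
  calc |c0 + c2 * x ^ 2 + c4 * x ^ 4| ≤ |c0| + |c2 * x ^ 2| + |c4 * x ^ 4| := abs_add_three _ _ _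
    _ = |c0| * 1 + |c2| * x ^ 2 + |c4| * x ^ 4 := by
        rw [abs_mul, abs_mul, abs_of_nonneg (by positivity : (0:ℝ) ≤ x ^ 2),
          abs_of_nonneg (by positivity : (0:ℝ) ≤ x ^ 4), mul_one]
    _ ≤ |c0| * x ^ 4 + |c2| * x ^ 4 + |c4| * x ^ 4 := by
        gcongr
    _ = (|c0| + |c2| + |c4|) * x ^ 4 := by ring

/-- **Majorant for the certificate**: for `u ≥ m + 2`,
`|V_m(u)| ≤ (2m+2)!·(|c₀|+|c₂|+|c₄|)/(8u²)` where `V_m` is the certificate of file 1 (displayed) and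
`c₀, c₂, c₄` its three coefficient polynomials in `n = m+1` (pair the `i`-th numerator factor `u−m+i` with the
denominator factor `2u−m+½+i`; the remaining denominator factors are `≥ u, 2u, 2u` and `(2u−m−3/2)² ≥ u²`).
[cite: KrattenthalerZudilin2019, §2 (the family r̃_n)] -/
theorem certificate_abs_le (m u : ℕ) (hu : m + 2 ≤ u) :
    |(fun v : ℕ => ((2 * m + 2)! : ℝ) * (v : ℝ)
          * ((13 - 20 * ((m : ℝ) + 1) - 1632 * ((m : ℝ) + 1) ^ 2 + 976 * ((m : ℝ) + 1) ^ 3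
                + 23520 * ((m : ℝ) + 1) ^ 4 + 3392 * ((m : ℝ) + 1) ^ 5 - 141824 * ((m : ℝ) + 1) ^ 6
                - 224512 * ((m : ℝ) + 1) ^ 7 - 101120 * ((m : ℝ) + 1) ^ 8)
              + (640 + 512 * ((m : ℝ) + 1) + 768 * ((m : ℝ) + 1) ^ 2 - 37888 * ((m : ℝ) + 1) ^ 3
                + 49152 * ((m : ℝ) + 1) ^ 4 + 299008 * ((m : ℝ) + 1) ^ 5
                + 225280 * ((m : ℝ) + 1) ^ 6) * (v : ℝ) ^ 2
              + (-3328 + 5120 * ((m : ℝ) + 1) + 14336 * ((m : ℝ) + 1) ^ 2 - 12288 * ((m : ℝ) + 1) ^ 3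
                - 20480 * ((m : ℝ) + 1) ^ 4) * (v : ℝ) ^ 4)
          * (∏ i ∈ range (2 * m + 1), ((v : ℝ) - m + i))
          / ((2 * (v : ℝ) - m - 3 / 2) ^ 2
              * ∏ j ∈ range (2 * m + 3), (2 * (v : ℝ) - m - 1 / 2 + j) ^ 2)) u|
      ≤ ((2 * m + 2)! : ℝ) * (|(13 - 20 * ((m : ℝ) + 1) - 1632 * ((m : ℝ) + 1) ^ 2 + 976 * ((m : ℝ) + 1) ^ 3
                + 23520 * ((m : ℝ) + 1) ^ 4 + 3392 * ((m : ℝ) + 1) ^ 5 - 141824 * ((m : ℝ) + 1) ^ 6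
                - 224512 * ((m : ℝ) + 1) ^ 7 - 101120 * ((m : ℝ) + 1) ^ 8)| + |(640 + 512 * ((m : ℝ) + 1) + 768 * ((m : ℝ) + 1) ^ 2 - 37888 * ((m : ℝ) + 1) ^ 3
                + 49152 * ((m : ℝ) + 1) ^ 4 + 299008 * ((m : ℝ) + 1) ^ 5
                + 225280 * ((m : ℝ) + 1) ^ 6)| + |(-3328 + 5120 * ((m : ℝ) + 1) + 14336 * ((m : ℝ) + 1) ^ 2 - 12288 * ((m : ℝ) + 1) ^ 3
                - 20480 * ((m : ℝ) + 1) ^ 4)|) / (8 * (u : ℝ) ^ 2) := by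
  dsimp only
  set x : ℝ := (u : ℝ) with hx
  set c0 : ℝ := (13 - 20 * ((m : ℝ) + 1) - 1632 * ((m : ℝ) + 1) ^ 2 + 976 * ((m : ℝ) + 1) ^ 3
                + 23520 * ((m : ℝ) + 1) ^ 4 + 3392 * ((m : ℝ) + 1) ^ 5 - 141824 * ((m : ℝ) + 1) ^ 6
                - 224512 * ((m : ℝ) + 1) ^ 7 - 101120 * ((m : ℝ) + 1) ^ 8) with hc0
  set c2 : ℝ := (640 + 512 * ((m : ℝ) + 1) + 768 * ((m : ℝ) + 1) ^ 2 - 37888 * ((m : ℝ) + 1) ^ 3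
                + 49152 * ((m : ℝ) + 1) ^ 4 + 299008 * ((m : ℝ) + 1) ^ 5
                + 225280 * ((m : ℝ) + 1) ^ 6) with hc2
  set c4 : ℝ := (-3328 + 5120 * ((m : ℝ) + 1) + 14336 * ((m : ℝ) + 1) ^ 2 - 12288 * ((m : ℝ) + 1) ^ 3
                - 20480 * ((m : ℝ) + 1) ^ 4) with hc4
  have hxm : (m : ℝ) + 2 ≤ x := by rw [hx]; exact_mod_cast hu
  have hm0 : (0 : ℝ) ≤ m := Nat.cast_nonneg m
  have hx1 : 1 ≤ x := by linarith
  have hx0 : 0 < x := by linarith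
  -- the core comparison with `e_i = x − m + i`, `d_j = 2x − m − ½ + j`, `k = 2m+1`
  have hcore := core_bound (2 * m + 1) (by omega) (fun i => x - m + i)
    (fun j => 2 * x - m - 1 / 2 + j) (fun i => by have := (Nat.cast_nonneg i : (0:ℝ) ≤ i); linarith)
    (fun i => by push_cast; linarith) (fun j => by have := (Nat.cast_nonneg j : (0:ℝ) ≤ j); linarith)
  have hd0 : x ≤ 2 * x - m - 1 / 2 + ((0 : ℕ) : ℝ) := by push_cast; linarith
  have hdk : 2 * x ≤ 2 * x - m - 1 / 2 + ((2 * m + 1 : ℕ) : ℝ) := by push_cast; linarith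
  have hdk1 : 2 * x ≤ 2 * x - m - 1 / 2 + ((2 * m + 1 + 1 : ℕ) : ℝ) := by push_cast; linarith
  have hq : x ≤ 2 * x - m - 3 / 2 := by linarith
  have hNDnn : 0 ≤ (∏ i ∈ range (2 * m + 1), (x - m + i))
      / ∏ j ∈ range (2 * m + 1 + 2), (2 * x - m - 1 / 2 + j) ^ 2 :=
    div_nonneg (prod_nonneg fun i _ => by have := (Nat.cast_nonneg i : (0:ℝ) ≤ i); linarith)
      (prod_nonneg fun j _ => sq_nonneg _)
  have hND : (∏ i ∈ range (2 * m + 1), (x - m + i))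
      / ∏ j ∈ range (2 * m + 1 + 2), (2 * x - m - 1 / 2 + j) ^ 2 ≤ 1 / (8 * x ^ 5) := by
    refine hcore.trans ?_
    apply one_div_le_one_div_of_le (by positivity)
    have h1 : x ^ 2 ≤ (2 * x - m - 1 / 2 + ((0 : ℕ) : ℝ)) ^ 2 := pow_le_pow_left₀ hx0.le hd0 2
    have h3 : (2 * x) ^ 2 ≤ (2 * x - m - 1 / 2 + ((2 * m + 1 + 1 : ℕ) : ℝ)) ^ 2 :=
      pow_le_pow_left₀ (by positivity) hdk1 2
    calc 8 * x ^ 5 = x ^ 2 * (2 * x) * (2 * x) ^ 2 := by ring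
      _ ≤ (2 * x - m - 1 / 2 + ((0 : ℕ) : ℝ)) ^ 2 * (2 * x - m - 1 / 2 + ((2 * m + 1 : ℕ) : ℝ))
          * (2 * x - m - 1 / 2 + ((2 * m + 1 + 1 : ℕ) : ℝ)) ^ 2 :=
        mul_le_mul (mul_le_mul h1 hdk (by positivity) (sq_nonneg _)) h3 (by positivity)
          (mul_nonneg (sq_nonneg _) (by linarith))
  have hC := abs_quartic_le c0 c2 c4 x hx1
  have hfac : (0 : ℝ) ≤ ((2 * m + 2)! : ℝ) := by positivity
  have h23 : 2 * m + 3 = 2 * m + 1 + 2 := by ring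
  rw [h23]
  -- assemble
  have hsq : x ^ 2 ≤ (2 * x - m - 3 / 2) ^ 2 := by nlinarith
  calc |((2 * m + 2)! : ℝ) * x * (c0 + c2 * x ^ 2 + c4 * x ^ 4)
          * (∏ i ∈ range (2 * m + 1), (x - m + i))
          / ((2 * x - m - 3 / 2) ^ 2 * ∏ j ∈ range (2 * m + 1 + 2), (2 * x - m - 1 / 2 + j) ^ 2)|
      = ((2 * m + 2)! : ℝ) * x * |c0 + c2 * x ^ 2 + c4 * x ^ 4|
          * ((∏ i ∈ range (2 * m + 1), (x - m + i))
              / ∏ j ∈ range (2 * m + 1 + 2), (2 * x - m - 1 / 2 + j) ^ 2) / (2 * x - m - 3 / 2) ^ 2 := by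
        rw [show ((2 * m + 2)! : ℝ) * x * (c0 + c2 * x ^ 2 + c4 * x ^ 4)
            * (∏ i ∈ range (2 * m + 1), (x - m + i))
            / ((2 * x - m - 3 / 2) ^ 2 * ∏ j ∈ range (2 * m + 1 + 2), (2 * x - m - 1 / 2 + j) ^ 2)
            = ((2 * m + 2)! : ℝ) * x * (c0 + c2 * x ^ 2 + c4 * x ^ 4)
            * ((∏ i ∈ range (2 * m + 1), (x - m + i))
              / ∏ j ∈ range (2 * m + 1 + 2), (2 * x - m - 1 / 2 + j) ^ 2) / (2 * x - m - 3 / 2) ^ 2 by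
              rw [mul_comm ((2 * x - m - 3 / 2) ^ 2), ← div_div, mul_div_assoc]]
        rw [abs_div, abs_mul, abs_mul, abs_mul, abs_of_nonneg hfac, abs_of_nonneg hx0.le,
          abs_of_nonneg hNDnn, abs_of_nonneg (sq_nonneg (2 * x - m - 3 / 2))]
    _ ≤ ((2 * m + 2)! : ℝ) * x * ((|c0| + |c2| + |c4|) * x ^ 4) * (1 / (8 * x ^ 5)) / x ^ 2 := by
        gcongr
    _ = ((2 * m + 2)! : ℝ) * (|c0| + |c2| + |c4|) / (8 * x ^ 2) := by
        field_simp

/-- **The certificate tends to `0`**: `V_m(u) → 0` as `u → ∞` (from `certificate_abs_le`: `|V_m(u)| ≤ K/u²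
≤ K/u`). [cite: KrattenthalerZudilin2019, §2 (the family r̃_n)] -/
theorem certificate_tendsto_zero (m : ℕ) :
    Tendsto (fun v : ℕ => ((2 * m + 2)! : ℝ) * (v : ℝ)
          * ((13 - 20 * ((m : ℝ) + 1) - 1632 * ((m : ℝ) + 1) ^ 2 + 976 * ((m : ℝ) + 1) ^ 3
                + 23520 * ((m : ℝ) + 1) ^ 4 + 3392 * ((m : ℝ) + 1) ^ 5 - 141824 * ((m : ℝ) + 1) ^ 6
                - 224512 * ((m : ℝ) + 1) ^ 7 - 101120 * ((m : ℝ) + 1) ^ 8)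
              + (640 + 512 * ((m : ℝ) + 1) + 768 * ((m : ℝ) + 1) ^ 2 - 37888 * ((m : ℝ) + 1) ^ 3
                + 49152 * ((m : ℝ) + 1) ^ 4 + 299008 * ((m : ℝ) + 1) ^ 5
                + 225280 * ((m : ℝ) + 1) ^ 6) * (v : ℝ) ^ 2
              + (-3328 + 5120 * ((m : ℝ) + 1) + 14336 * ((m : ℝ) + 1) ^ 2 - 12288 * ((m : ℝ) + 1) ^ 3
                - 20480 * ((m : ℝ) + 1) ^ 4) * (v : ℝ) ^ 4)
          * (∏ i ∈ range (2 * m + 1), ((v : ℝ) - m + i))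
          / ((2 * (v : ℝ) - m - 3 / 2) ^ 2
              * ∏ j ∈ range (2 * m + 3), (2 * (v : ℝ) - m - 1 / 2 + j) ^ 2)) atTop (𝓝 0) := by
  set K : ℝ := ((2 * m + 2)! : ℝ) * (|(13 - 20 * ((m : ℝ) + 1) - 1632 * ((m : ℝ) + 1) ^ 2 + 976 * ((m : ℝ) + 1) ^ 3
                + 23520 * ((m : ℝ) + 1) ^ 4 + 3392 * ((m : ℝ) + 1) ^ 5 - 141824 * ((m : ℝ) + 1) ^ 6
                - 224512 * ((m : ℝ) + 1) ^ 7 - 101120 * ((m : ℝ) + 1) ^ 8)| + |(640 + 512 * ((m : ℝ) + 1) + 768 * ((m : ℝ) + 1) ^ 2 - 37888 * ((m : ℝ) + 1) ^ 3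
                + 49152 * ((m : ℝ) + 1) ^ 4 + 299008 * ((m : ℝ) + 1) ^ 5
                + 225280 * ((m : ℝ) + 1) ^ 6)| + |(-3328 + 5120 * ((m : ℝ) + 1) + 14336 * ((m : ℝ) + 1) ^ 2 - 12288 * ((m : ℝ) + 1) ^ 3
                - 20480 * ((m : ℝ) + 1) ^ 4)|) with hK
  have hK0 : 0 ≤ K := by positivity
  refine squeeze_zero_norm' ?_ (tendsto_const_div_atTop_nhds_zero_nat K)
  filter_upwards [eventually_ge_atTop (m + 2)] with u hu
  rw [Real.norm_eq_abs]
  refine (certificate_abs_le m u hu).trans ?_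
  have hx1 : (1 : ℝ) ≤ u := by exact_mod_cast (show 1 ≤ u by omega)
  rw [div_le_div_iff₀ (by positivity) (by positivity)]
  nlinarith [hK0, mul_nonneg hK0 (by positivity : (0:ℝ) ≤ (u:ℝ))]

/-- **The `n = 0` certificate tends to `0`**: `0 ≤ V⁰(u) ≤ 6/u²` for `u ≥ 1`, where
`V⁰(u) = 2(14u⁴ + 21u³ + 19u²/2 + 39u/16 + 117/128)/((2u−½)²(2u+½)²(2u+3/2)²)`.
[cite: KrattenthalerZudilin2019, §2 (the family r̃_n)] -/
theorem certificate_zero_tendsto_zero :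
    Tendsto (fun v : ℕ => 2 * (14 * (v : ℝ) ^ 4 + 21 * (v : ℝ) ^ 3 + 19 / 2 * (v : ℝ) ^ 2 + 39 / 16 * (v : ℝ)
            + 117 / 128)
          / ((2 * (v : ℝ) - 1 / 2) ^ 2 * (2 * (v : ℝ) + 1 / 2) ^ 2 * (2 * (v : ℝ) + 3 / 2) ^ 2)) atTop (𝓝 0) := by
  refine squeeze_zero_norm' ?_ (tendsto_const_div_atTop_nhds_zero_nat 6)
  filter_upwards [eventually_ge_atTop 1] with u hu
  have hx1 : (1 : ℝ) ≤ u := by exact_mod_cast hu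
  have hnum : 0 ≤ 2 * (14 * (u : ℝ) ^ 4 + 21 * (u : ℝ) ^ 3 + 19 / 2 * (u : ℝ) ^ 2 + 39 / 16 * (u : ℝ)
      + 117 / 128) := by positivity
  have hden : 0 < (2 * (u : ℝ) - 1 / 2) ^ 2 * (2 * (u : ℝ) + 1 / 2) ^ 2 * (2 * (u : ℝ) + 3 / 2) ^ 2 := by
    have : 0 < 2 * (u : ℝ) - 1 / 2 := by linarith
    positivity
  rw [Real.norm_eq_abs, abs_of_nonneg (div_nonneg hnum hden.le), div_le_div_iff₀ hden (by positivity)]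
  have hu0 : (0 : ℝ) ≤ u := by linarith
  nlinarith [mul_nonneg hu0 hu0, mul_nonneg (mul_nonneg hu0 hu0) hu0,
    mul_nonneg (mul_nonneg hu0 hu0) (mul_nonneg hu0 hu0), mul_nonneg (mul_nonneg (mul_nonneg hu0 hu0) (mul_nonneg hu0 hu0)) hu0,
    mul_nonneg (mul_nonneg (mul_nonneg hu0 hu0) (mul_nonneg hu0 hu0)) (mul_nonneg hu0 hu0)]

end CatalanRTilde

end Literature.NumberTheory.Irrationality.KrattenthalerZudilin2019
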